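import Mathlib
import Summits.Ventures.PercRepro2.SwOutCrossJunctionQSwG
import Summits.Ventures.PercRepro2.SwOutCrossJunctionExample

/-!
# An instance of Theorem A_cross with THE MARK AT A DROPPED VERTEX (blind cell PercRepro2,
night-4 g26, 2026-08-28; proofs/NIGHT4-G26.md §3‴)

The graph `crossEx` of g24 (`l = 0`, `h = 1`, the junction `u = 3`, the dropped vertices
`p₁ = 4`, `p₂ = 5` joined by the cross edge `p₁p₂`, the u-arm `x = 6`, the vertex `2` with its
edge to `l`) with the MARK AT THE DROPPED VERTEX `o = p₁ = 4`: no landed junction theorem applies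
(they assume `o ≠ p i`); `CrossJunctionQ` does — **row (SW) holds** (`sw_crossExQ`) by
`sw_of_crossJunctionQ` with the cross-edge graph `⊤` on `Fin 2` and `r = 0`.
-/

namespace Summit.Ventures.PercRepro2

namespace CrossArm

open Hull LocRows

open scoped Classical

/-- The cross junction of `crossEx` with the mark at the dropped vertex `p₁ = 4`. -/

theorem crossExQ_junction :
    CrossJunctionQ crossEx ({0}ᶜ) 1 3 crossExP (⊤ : SimpleGraph (Fin 2)) 4 0 where
  hne_hu := by decide
  hne_hp := by decide
  hne_up := by decide
  p_inj := by decide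
  hqr := rfl
  hext_r := ⟨6, 0, rfl, by simp, by decide, by decide⟩
  hhU := by simp
  huU := by simp
  hpU := by intro i; fin_cases i <;> simp [crossExP]
  hloop_h := by intro e; fin_cases e <;> decide
  hloop_u := by intro e; fin_cases e <;> decide
  hnadj := by intro e; fin_cases e <;> decide
  hnadj_p := by intro i e; fin_cases i <;> fin_cases e <;> decide
  hup := by
    intro i
    fin_cases i
    · exact ⟨2, rfl⟩
    · exact ⟨3, rfl⟩
  hcross := by
    intro i j hij
    fin_cases i <;> fin_cases j
    · exact absurd hij (by decide)
    · exact ⟨4, rfl⟩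
    · exact ⟨4, by decide⟩
    · exact absurd hij (by decide)
  hcross_adj := by
    intro i j e
    revert e
    fin_cases i <;> fin_cases j <;> decide
  hcross_simple := by
    intro i j e e'
    revert e e'
    fin_cases i <;> fin_cases j <;> decide
  hu_adj_h := by
    intro e x he hx
    fin_cases e <;> simp only [crossEx] at he
    · exact (crossEx_no_edge_at he (by decide) (by decide)).elim
    · obtain rfl := crossEx_eq_of_edge he (by decide)
      exact ⟨0, by decide⟩
    · obtain rfl := crossEx_eq_of_edge he (by decide)
      exact absurd rfl (hx 0)
    · obtain rfl := crossEx_eq_of_edge he (by decide)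
      exact absurd rfl (hx 1)
    all_goals exact (crossEx_no_edge_at he (by decide) (by decide)).elim
  hp_in := by
    intro i e x he hxU
    fin_cases i <;> simp only [crossExP] at he
    · fin_cases e <;> simp only [crossEx] at he
      · exact (crossEx_no_edge_at he (by decide) (by decide)).elim
      · exact (crossEx_no_edge_at he (by decide) (by decide)).elim
      · rw [Sym2.eq_swap] at he
        obtain rfl := crossEx_eq_of_edge he (by decide)
        exact Or.inl rfl
      · exact (crossEx_no_edge_at he (by decide) (by decide)).elim
      · obtain rfl := crossEx_eq_of_edge he (by decide)
        exact Or.inr ⟨1, rfl⟩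
      · exact (crossEx_no_edge_at he (by decide) (by decide)).elim
      · obtain rfl := crossEx_eq_of_edge he (by decide)
        exact absurd hxU (by simp)
      · exact (crossEx_no_edge_at he (by decide) (by decide)).elim
      · exact (crossEx_no_edge_at he (by decide) (by decide)).elim
    · fin_cases e <;> simp only [crossEx] at he
      · exact (crossEx_no_edge_at he (by decide) (by decide)).elim
      · exact (crossEx_no_edge_at he (by decide) (by decide)).elim
      · exact (crossEx_no_edge_at he (by decide) (by decide)).elim
      · rw [Sym2.eq_swap] at he
        obtain rfl := crossEx_eq_of_edge he (by decide)
        exact Or.inl rfl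
      · rw [Sym2.eq_swap] at he
        obtain rfl := crossEx_eq_of_edge he (by decide)
        exact Or.inr ⟨0, rfl⟩
      · exact (crossEx_no_edge_at he (by decide) (by decide)).elim
      · exact (crossEx_no_edge_at he (by decide) (by decide)).elim
      · obtain rfl := crossEx_eq_of_edge he (by decide)
        exact absurd hxU (by simp)
      · exact (crossEx_no_edge_at he (by decide) (by decide)).elim
  hout := by
    intro x hx hx1 hx2 hx3
    simp only [Set.mem_compl_iff, Set.mem_singleton_iff] at hx
    fin_cases x
    · exact absurd rfl hx
    · exact absurd rfl hx1
    · exact Or.inl ⟨8, 0, rfl, by simp⟩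
    · exact absurd rfl hx3
    · exact absurd rfl hx2
    · exact Or.inl ⟨7, 0, rfl, by simp⟩
    · exact Or.inl ⟨5, 0, rfl, by simp⟩

/-- **Row (SW) with the mark at a dropped vertex**: on `crossEx` with `o = p₁ = 4`. -/
theorem sw_crossExQ : Sw crossEx 0 1 4 :=
  sw_of_crossJunctionQ SimpleGraph.connected_top (by decide) crossExQ_junction

end CrossArm

end Summit.Ventures.PercRepro2
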